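import Summits.BirchSwinnertonDyer.BirchSwinnertonDyer.Theses.SignedBaseChange
import Summits.BirchSwinnertonDyer.BirchSwinnertonDyer.Theorems.SignedBaseChangeTwistPairGreenbergProductDivisibilityStubFrameDataBCS
import HarnessLib

/-!
# K1 `TwistPairGreenbergProductDivisibility` (stmt-BirchSwinnertonDyer-20249) ⇐ the product divisibility under
# the BCS base-change splitting package — composition of line `birth` v4, LANDED as glue (`--supports` 20249)

Route `SignedBaseChange`, crux K1, line `birth` reshape v4 (lead prover sbc-p1, skeleton 71588345): the `∃`
half WITH the Burungale–Castella–Skinner 2025 Prop. 5.2.1 splitting package is the landed theorem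
`Theorems.SignedBaseChangeK1FrameDataBCS.stub_frameDataBCS` (p514288); THIS FILE lands the composition: the
remaining registered stub `stub_productDivisibilityBCS` — the PRODUCT Greenberg divisibility
`s·ch(X_Gr₂(W/K))·ch(X_Gr₂(W'/K)) ⊆ (G·G')` for every datum of an X7 pair (surjective `ρ̄`, `p ≥ 5`) satisfying
K1's eighteen conditions AND (Heeg), `2` split in `K`, `d_K` odd `≠ −3`, `d ≡ 1 (mod 8)`, primes of `d` split in
`K`, `d` a non-residue mod `p`, and for odd `ℓ ∣ N`: `d` a non-zero square mod `ℓ` iff `p ∤ ℓ + 1` (= BCS Prop.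
5.2.1 (i)–(iii) for `F = ℚ(√d)` by the decomposition law) — i.e. "BCS Prop. 5.2.1 (Greenberg clause) at a
supersingular `p`" in the tree's two-variable currency; no print; the crux's open content — IMPLIES K1.
WEAKER hypothesis than the v3 glue `SignedBaseChangeK1Glue.twistPairGreenbergProductDivisibility_of_productDivisibility`
(p512926), same conclusion. Spelled out VERBATIM as the registered stub signature (no `def`, no named fact).
-/

-- D-0017: single-problem summit, the namespace repeats the problem name by design.
set_option linter.dupNamespace false
set_option autoImplicit false

namespace Summit.BirchSwinnertonDyer.BirchSwinnertonDyer.Theorems.SignedBaseChangeK1Glue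

/-- **K1 from the product divisibility under the BCS splitting package.** If the registered stub
`stub_productDivisibilityBCS` of line `birth` v4 holds (verbatim as hypothesis), then
`TwistPairGreenbergProductDivisibility` holds: instantiate at the frame data of
`SignedBaseChangeK1FrameDataBCS.stub_frameDataBCS` (landed), discarding the splitting package from the witness. -/
theorem twistPairGreenbergProductDivisibility_of_productDivisibilityBCS
    (hPD : ∀ (W : WeierstrassCurve ℚ) [W.IsElliptic] [W.IsGloballyMinimal] (p : ℕ) [Fact p.Prime], 5 ≤ p → Literature.NumberTheory.EllipticCurves.Rank1Residual.ClassX7 W p → Literature.NumberTheory.EllipticCurves.Rank1Residual.Surj W p → ∀ (K : Type) [Field K] [NumberField K] (ι : PadicAlgCl p ≃+* ℂ) (v vbar : IsDedekindDomain.HeightOneSpectrum (NumberField.RingOfIntegers K)) (κ₁ κ₂ : Literature.NumberTheory.EllipticCurves.ZpExtension K p) (γ₁ γ₂ : Field.absoluteGaloisGroup K) [Fact (Literature.NumberTheory.EllipticCurves.ZpExtension.IsTopGeneratorPair κ₁ κ₂ γ₁ γ₂)] [NeZero (NumberField.discr K).natAbs] (N : ℕ) [NeZero N] (f : CuspForm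 (CongruenceSubgroup.Gamma0 N) 2) (d : ℤ) (W' : WeierstrassCurve ℚ) [W'.IsElliptic] [W'.IsGloballyMinimal] (C : WeierstrassCurve.VariableChange ℚ) (N' : ℕ) [NeZero N'] (f' : CuspForm (CongruenceSubgroup.Gamma0 N') 2), Literature.NumberTheory.EllipticCurves.ModularForms.IsNewformOf W f → (N : ℤ) = W.conductorNorm ℤ → Literature.NumberTheory.EllipticCurves.ModularForms.IsNewformOf W' f' → (N' : ℤ) = W'.conductorNorm ℤ → Squarefree d → 1 < d → (∀ q : ℕ, q.Prime → Literature.NumberTheory.EllipticCurves.BurungaleSkinnerTianWan2024.RamifiedInQuadratic d q → q ≠ p ∧ ¬ q ∣ N ∧ ¬ (q : ℤ) ∣ NumberField.discr K) → C • W' = W.quadraticTwist (d : ℚ) → Literature.NumberTheory.EllipticCurves.IsImaginaryQuadratic K → ((Ideal.span {(p : ℤ)}).primesOver (NumberField.RingOfIntegers K)).ncard = 2 → ((p : ℕ) : NumberField.RingOfIntegers K) ∈ v.asIdeal → ((p : ℕ) : NumberField.RingOfIntegers K) ∈ vbar.asIdeal → vbar ≠ v → (∀ (w : NumberField.InfinitePlace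 K) (k : NumberField.RingOfIntegers K), k ∈ v.asIdeal ↔ ‖ι.symm (w.embedding (k : K))‖ < 1) → IsCoprime (N : ℤ) (NumberField.discr K) → (∀ ρ : Literature.NumberTheory.GaloisRepresentations.ModPGaloisRep K (ZMod p) 2, (W.baseChange K).IsTorsionGaloisRep p ρ → Literature.NumberTheory.GaloisRepresentations.FramedRep.IsAbsolutelyIrreducible ρ) → κ₁.IsCyclotomic → κ₂.IsAnticyclotomic → (∀ ℓ : ℕ, ℓ.Prime → ℓ ∣ N → ((Ideal.span {(ℓ : ℤ)}).primesOver (NumberField.RingOfIntegers K)).ncard = 2) → ((Ideal.span {(2 : ℤ)}).primesOver (NumberField.RingOfIntegers K)).ncard = 2 → (Odd (NumberField.discr K) ∧ NumberField.discr K ≠ -3) → d % 8 = 1 → (∀ ℓ : ℕ, ℓ.Prime → (ℓ : ℤ) ∣ d → ((Ideal.span {(ℓ : ℤ)}).primesOver (NumberField.RingOfIntegers K)).ncard = 2) → ¬ IsSquare ((d : ℤ) : ZMod p) → (∀ ℓ : ℕ, ℓ.Prime → ℓ ∣ N → ℓ ≠ 2 → ((d : ℤ) : ZMod ℓ) ≠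 0 ∧ (IsSquare ((d : ℤ) : ZMod ℓ) ↔ ¬ p ∣ ℓ + 1)) → ∀ (Ω δ : ℂ) (Ωp : (Literature.NumberTheory.EllipticCurves.unrIntegers p)ˣ) (LK G G' : PowerSeries (PowerSeries (PadicComplexInt p))), Ω ≠ 0 → (δ ^ 2 = (NumberField.discr K : ℂ) ∨ δ ^ 2 = -(NumberField.discr K : ℂ)) → Literature.NumberTheory.EllipticCurves.IsKatzMeasure₂ ι v vbar ∅ κ₁ κ₂ γ₁⁻¹ γ₂⁻¹ 1 Ω δ ((Ωp : Literature.NumberTheory.EllipticCurves.unrIntegers p) : PadicComplex p) LK → Literature.NumberTheory.EllipticCurves.IsGreenbergLFunctionAnyRoot₂ ι v vbar κ₁ κ₂ γ₁⁻¹ γ₂⁻¹ f (NumberField.discr K).natAbs (NumberField.classNumber K) LK G → Literature.NumberTheory.EllipticCurves.IsGreenbergLFunctionAnyRoot₂ ι v vbar κ₁ κ₂ γ₁⁻¹ γ₂⁻¹ f' (NumberField.discr K).natAbs (NumberField.classNumber K) LK G' → ∀ J : ℤ_[p] →+* PadicComplexInt p, (∀ x : ℤ_[p], ((J x : PadicComplexInt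 p) : PadicComplex p) = ((x : ℚ_[p]) : PadicComplex p)) → ∃ s : PowerSeries (PadicComplexInt p), s ≠ 0 ∧ Ideal.span {PowerSeries.map (PowerSeries.C (R := PadicComplexInt p)) s} * ((WeierstrassCurve.XGr₂.charIdeal (W.baseChange K) p κ₁ κ₂ vbar γ₁ γ₂).map (Literature.NumberTheory.EllipticCurves.IwasawaAlgebra₂.toUnr₂ p J) * (WeierstrassCurve.XGr₂.charIdeal (W'.baseChange K) p κ₁ κ₂ vbar γ₁ γ₂).map (Literature.NumberTheory.EllipticCurves.IwasawaAlgebra₂.toUnr₂ p J)) ≤ Ideal.span {G * G'}) :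
    Summit.BirchSwinnertonDyer.BirchSwinnertonDyer.Theses.SignedBaseChange.TwistPairGreenbergProductDivisibility := by
  intro hmodP W _ _ p _ hp hX hs
  obtain ⟨K, iF, iNF, ι, v, vbar, κ₁, κ₂, γ₁, γ₂, iPair, iD, N, iN, f, d, W', iE', iM', C, N', iN', f', h0, h1, h2, h3, h4, h5, h6, h7, h8, h9, h10, h11, h12, h13, h14, h15, h16, h17, e1, e2, e3, e4, e5, e6, e7⟩ :=
    SignedBaseChangeK1FrameDataBCS.stub_frameDataBCS hmodP W p hp hX hs
  exact ⟨K, iF, iNF, ι, v, vbar, κ₁, κ₂, γ₁, γ₂, iPair, iD, N, iN, f, d, W', iE', iM', C, N', iN', f', h0, h1, h2, h3, h4, h5, h6, h7, h8, h9, h10, h11, h12, h13, h14, h15, h16, h17,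
    hPD W p hp hX hs K ι v vbar κ₁ κ₂ γ₁ γ₂ N f d W' C N' f' h0 h1 h2 h3 h4 h5 h6 h7 h8 h9 h10 h11 h12 h13 h14 h15 h16 h17 e1 e2 e3 e4 e5 e6 e7⟩

end Summit.BirchSwinnertonDyer.BirchSwinnertonDyer.Theorems.SignedBaseChangeK1Glue
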